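/-
Copyright (c) 2026. All rights reserved.
Released under Apache 2.0 license as described in the file LICENSE.
Authors: abc-iut cell — seat abc-iut-w4-d071 (wave 4, gen 4; integrated Thm 5.4 line v1 p444123 / v2 p445192 /
v3 «canonical B^temp», L3 lead α101), after abc-iut-w4-d089 gen 6 (p442343 and the (iii) canonical umbrella).
-/
import Literature.AnabelianGeometry.SemiGraphs.ArithThm54IntegratedChartCongruence
import Literature.AnabelianGeometry.SemiGraphs.ArithBranchPairAugChartModKernel
import Literature.AnabelianGeometry.SemiGraphs.ArithLevelCofinalityOuterAction
import Literature.AnabelianGeometry.SemiGraphs.ArithLevelKernelVertexLift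
import Literature.AnabelianGeometry.SemiGraphs.ArithVertGpCompact
import Literature.AnabelianGeometry.SemiGraphs.ArithLevelKerCongruenceSelfNormalizingChart
import Literature.AnabelianGeometry.SemiGraphs.ArithBTempOuterModel
import Literature.AnabelianGeometry.SemiGraphs.ArithBTempCentraliserFree
import Literature.AnabelianGeometry.SemiGraphs.ArithBTempOuterModelCompat
import HarnessLib

/-!
# [SemiAnbd] THEOREM 5.4 (i) ∧ (ii) ∧ (iii) at the outer models, INTEGRATED, v4 — hcof-FREE (AI4″) terms, `hself`
# discharged, the CANONICAL `B^temp(φ)` with BOTH its inputs derived from the dictionary — proof-only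

Mochizuki, *Semi-graphs of anabelioids*, Publ. RIMS **42** (2006), §0 p. 5, §5 Def 5.1 (i) p. 62, Prop 5.2 (iv) p. 64,
Rmk 5.3.1 p. 65, Thm 5.4 (i)(ii)(iii) p. 66 [cite: MochizukiSemiAnbd2006, Thm 5.4, p. 66].

PROOF-ONLY file (abc-iut cell, layer L3, T54 board; seat abc-iut-w4-d071 gen 4, integrated line v1 p444123 / v2 p445192 /
v3 p445687).  No definition, no new named fact, no producer restated.  This is v3's twin with `hcompat` ALSO a term
(abc-iut-w4-d053's recipe 11:27:54Z: `compat_of_representatives ∘ btemp_representatives_of_dict`, ArithBTempOuterModel.lean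
p439273 + ArithBTempOuterModelCompat.lean p441630, fed with the `hrep𝒢`/`hrepℋ` (re-indexed along `e`), `hpre`/`hpost` and
`dict`/`θd`/`φc`/`hφc` binders and `φ.compat` + `IsOverA`).  As v3, it is v2
(`arithThm54_outerModels_chart_of_producers_of_congruenceContinuous_aug_modKernel_v2`, p445192: (AI4″) via
abc-iut-w4-d059's hcof-FREE `stabBranchPairAug_chart_outerAction_modKernel` with `hVc`/`hUclosed`/`hU` the tree terms
p442845/p438510/p442216; `hK1′` from `(n, hCC)` alone via abc-iut-w6-d117's p442489) with, in addition, the Thm 5.4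
(iii) datum `btemp` and its laws `hover`/`hbtempφ` INSTANTIATED at abc-iut-w4-d053's CANONICAL arithmetic `B^temp`
(ArithBTempOuterModel.lean p439273): `btemp φ h₁ h₂ := outerSemidirectProductMap ρ_𝔾 ρ_ℍ e φ̂_{φ_𝔾} (hcompat φ …) hZ`,
`(β, a) ↦ (β′, e a)`, with `hover := outerSemidirectProductSnd_outerSemidirectProductMap`, `hbtempφ :=
outerSemidirectProductMap_toOuterSemidirectProduct` (`δ = 1`), and the centraliser-freeness `hZ` DISCHARGED by
abc-iut-w4-d053's `centraliserFree_of_chartPullbackWith_iso` (ArithBTempCentraliserFree.lean p440786) at the locally open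
dictionary arrow — exactly abc-iut-w4-d089's (iii)-umbrella substitution `…_canonicalBTemp_of_dict`
(ArithThm54iiiUmbrellaOuterModelCanonical.lean), now on the INTEGRATED statement.  Final call: abc-iut-w4-d089's
`arithThm54_outerModels_chart_of_producers` (p439824).

* `arithThm54_outerModels_chart_of_producers_canonicalBTemp_of_dict` — per side: v2's list; across: `btemp hover hbtempφ`
  GONE (terms), `hcompat`/`hZ` GONE (terms); the Thm 5.4 (iii) datum now costs ONLY the dictionary / represented-action
  DESIGN data already on the list and `hcont` — continuity of the canonical `B^temp` for the two level topologies (the one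
  law abc-iut-w4-d053 leaves to the topology package: ℋ-side congruence-continuity, `hK1′`-class).

HONEST RESIDUAL per side: Cor39Hypotheses · finiteness · tower data hcof hS hfin hne hconn · hker · hfaithV · DESIGN hV hE
hopen hBR (F θ hrep) · T R Rc w d · n hCC · hinst (rfl) · noSwitchBase · hRcV hRcB · hest hbot; across: hcont · dict θd hlo
φc hφc hfaith hfull hpre hpost · he.  Nothing beyond composition is proved here; typed ≠ proved for the
residual inputs; Thm 5.4 for OUR tower decompositions; no side taken on [IUTchIII] Cor. 3.12.
-/

namespace Literature.AnabelianGeometry.SemiGraphs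

open _root_.CategoryTheory _root_.Topology _root_.Filter ProfiniteSemiGraph Literature.AnabelianGeometry.EtaleTheta
open scoped Pointwise

universe u v u₀

variable {Obj : Type u} [Category.{v} Obj] {𝓥 : SemiAnbdVocab.{u, v, u₀} Obj}
variable {𝔊 ℍ : ArithSemiGraph 𝓥} {e : 𝔊.PA ≃* ℍ.PA}
variable {𝒢 ℋ : ProfiniteSemiGraph.{u₀}}

/-- **[SemiAnbd] THEOREM 5.4 (i) ∧ (ii) ∧ (iii) at the outer models, INTEGRATED, v4 — for the CANONICAL `B^temp(φ)` with
its compatibility and centraliser-freeness inputs DERIVED from the dictionary** (abc-iut-w4-d053): (AI4″) hcof-free with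
`hVc`/`hUclosed`/`hU` terms, `hK1′` from `(n, hCC)`, `btemp/hover/hbtempφ/hcompat/hZ` terms; (iii) costs the dictionary
design data + `hcont`.  Residual: module docstring. [cite: MochizukiSemiAnbd2006, Thm 5.4, p. 66] -/
theorem arithThm54_outerModels_chart_of_producers_canonicalBTemp_of_dict
    -- ── the 𝔾 side: a cofinal Galois tower with characteristic levels, its chart, the outer model over `Π_A` ──
    (h39𝒢 : Cor39Hypotheses 𝒢) (D𝒢 : GaloisLevelData 𝒢)
    (hcof𝒢 : ∀ (X : CovObj 𝒢), X.IsTempered → ∀ p : X.Point, ∃ i : ℕ, ∀ j, i ≤ j → (D𝒢.S j).Splits (X.component p))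
    (hS𝒢 : ∀ n, (D𝒢.S n).Splits (D𝒢.S n)) (hfin𝒢 : ∀ n, (D𝒢.S n).IsFinite) (hne𝒢 : ∀ n, (D𝒢.S n).HasNonemptyFibres)
    (hconn𝒢 : ∀ (n : ℕ) (p q : (D𝒢.S n).Point), (D𝒢.S n).SameComponent p q)
    [Finite 𝒢.graph.Vertex] [Finite 𝒢.graph.Branch]
    [Finite 𝒢.graph.Edge]
    (ρ𝒢 : 𝔊.PA →* TopOut (D𝒢.chart h39𝒢.toProp36Hypotheses.isCountable hcof𝒢 h39𝒢.toProp36Hypotheses.isConnected hS𝒢 hfin𝒢 hne𝒢).G) (baseAct𝒢 : 𝔊.PA →* Aut 𝒢.graph)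
    [inst𝒢 : TopologicalSpace (outerSemidirectProduct ρ𝒢)]
    (T𝒢 : ∀ w : 𝒢.graph.Vertex, D𝒢.PointSeq h39𝒢.toProp36Hypotheses.isCountable w) (R𝒢 : SemiGraph.RefBranches 𝒢.graph)
    (Rc𝒢 : ChartRepresentatives (D𝒢.chart h39𝒢.toProp36Hypotheses.isCountable hcof𝒢 h39𝒢.toProp36Hypotheses.isConnected hS𝒢 hfin𝒢 hne𝒢))
    -- Prop 3.6 (iv) at `ρ_𝔾(a)` / Def 5.1 (i)(c): the DESIGN data of the outer model (abc-iut-w4-d082's currency)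
    (hV𝒢 : ∀ (a : 𝔊.PA) (v : 𝒢.graph.Vertex) (H : Subgroup (D𝒢.chart h39𝒢.toProp36Hypotheses.isCountable hcof𝒢 h39𝒢.toProp36Hypotheses.isConnected hS𝒢 hfin𝒢 hne𝒢).G), H ∈ verticialSubgroups (D𝒢.chart h39𝒢.toProp36Hypotheses.isCountable hcof𝒢 h39𝒢.toProp36Hypotheses.isConnected hS𝒢 hfin𝒢 hne𝒢) v →
      ∃ φ : contMulAut (D𝒢.chart h39𝒢.toProp36Hypotheses.isCountable hcof𝒢 h39𝒢.toProp36Hypotheses.isConnected hS𝒢 hfin𝒢 hne𝒢).G, TopOut.mk _ φ = ρ𝒢 a ∧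
        H.map (φ : MulAut (D𝒢.chart h39𝒢.toProp36Hypotheses.isCountable hcof𝒢 h39𝒢.toProp36Hypotheses.isConnected hS𝒢 hfin𝒢 hne𝒢).G).toMonoidHom ∈ verticialSubgroups (D𝒢.chart h39𝒢.toProp36Hypotheses.isCountable hcof𝒢 h39𝒢.toProp36Hypotheses.isConnected hS𝒢 hfin𝒢 hne𝒢) ((baseAct𝒢 a).hom.vertexMap v))
    (hE𝒢 : ∀ (a : 𝔊.PA) (e : 𝒢.graph.Edge) (K : Subgroup (D𝒢.chart h39𝒢.toProp36Hypotheses.isCountable hcof𝒢 h39𝒢.toProp36Hypotheses.isConnected hS𝒢 hfin𝒢 hne𝒢).G), K ∈ edgeLikeSubgroups (D𝒢.chart h39𝒢.toProp36Hypotheses.isCountable hcof𝒢 h39𝒢.toProp36Hypotheses.isConnected hS𝒢 hfin𝒢 hne𝒢) e →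
      ∃ φ : contMulAut (D𝒢.chart h39𝒢.toProp36Hypotheses.isCountable hcof𝒢 h39𝒢.toProp36Hypotheses.isConnected hS𝒢 hfin𝒢 hne𝒢).G, TopOut.mk _ φ = ρ𝒢 a ∧
        K.map (φ : MulAut (D𝒢.chart h39𝒢.toProp36Hypotheses.isCountable hcof𝒢 h39𝒢.toProp36Hypotheses.isConnected hS𝒢 hfin𝒢 hne𝒢).G).toMonoidHom ∈ edgeLikeSubgroups (D𝒢.chart h39𝒢.toProp36Hypotheses.isCountable hcof𝒢 h39𝒢.toProp36Hypotheses.isConnected hS𝒢 hfin𝒢 hne𝒢) ((baseAct𝒢 a).hom.edgeMap e))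
    (hopen𝒢 : ∃ U : Subgroup 𝔊.PA, IsOpen (U : Set 𝔊.PA) ∧ ∀ a ∈ U,
      (∀ v, (baseAct𝒢 a).hom.vertexMap v = v) ∧ (∀ e, (baseAct𝒢 a).hom.edgeMap e = e) ∧
        ∀ b, (baseAct𝒢 a).hom.branchMap b = b)
    (hBR𝒢 : ∀ (a : 𝔊.PA) (b : 𝒢.graph.Branch) (v : 𝒢.graph.Vertex) (hb : 𝒢.graph.abuts b = some v)
      (φ : 𝒢.Gv v →ₜ* (D𝒢.chart h39𝒢.toProp36Hypotheses.isCountable hcof𝒢 h39𝒢.toProp36Hypotheses.isConnected hS𝒢 hfin𝒢 hne𝒢).G), IsVerticialHom (D𝒢.chart h39𝒢.toProp36Hypotheses.isCountable hcof𝒢 h39𝒢.toProp36Hypotheses.isConnected hS𝒢 hfin𝒢 hne𝒢) v φ →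
      ∃ Φ : contMulAut (D𝒢.chart h39𝒢.toProp36Hypotheses.isCountable hcof𝒢 h39𝒢.toProp36Hypotheses.isConnected hS𝒢 hfin𝒢 hne𝒢).G, TopOut.mk _ Φ = ρ𝒢 a ∧
        ∃ φ' : 𝒢.Gv ((baseAct𝒢 a).hom.vertexMap v) →ₜ* (D𝒢.chart h39𝒢.toProp36Hypotheses.isCountable hcof𝒢 h39𝒢.toProp36Hypotheses.isConnected hS𝒢 hfin𝒢 hne𝒢).G,
          IsVerticialHom (D𝒢.chart h39𝒢.toProp36Hypotheses.isCountable hcof𝒢 h39𝒢.toProp36Hypotheses.isConnected hS𝒢 hfin𝒢 hne𝒢) ((baseAct𝒢 a).hom.vertexMap v) φ' ∧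
          ∃ x' : (D𝒢.chart h39𝒢.toProp36Hypotheses.isCountable hcof𝒢 h39𝒢.toProp36Hypotheses.isConnected hS𝒢 hfin𝒢 hne𝒢).G,
            Subgroup.map (Φ : MulAut (D𝒢.chart h39𝒢.toProp36Hypotheses.isCountable hcof𝒢 h39𝒢.toProp36Hypotheses.isConnected hS𝒢 hfin𝒢 hne𝒢).G).toMonoidHom φ.toMonoidHom.range =
              Subgroup.map (MulAut.conj x').toMonoidHom φ'.toMonoidHom.range ∧
            Subgroup.map (Φ : MulAut (D𝒢.chart h39𝒢.toProp36Hypotheses.isCountable hcof𝒢 h39𝒢.toProp36Hypotheses.isConnected hS𝒢 hfin𝒢 hne𝒢).G).toMonoidHom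
                (Subgroup.map φ.toMonoidHom (𝒢.branchSubgroup b v hb)) =
              Subgroup.map (MulAut.conj x').toMonoidHom
                (Subgroup.map φ'.toMonoidHom
                  (𝒢.branchSubgroup ((baseAct𝒢 a).hom.branchMap b) ((baseAct𝒢 a).hom.vertexMap v)
                    ((baseAct𝒢 a).hom.abuts_branchMap b v hb))))
    (w𝒢 : 𝒢.graph.Vertex)
    -- CHARACTERISTIC finite levels (abc-iut-L3-t9 E1): `ker π_n` is the characteristic open core of level `d𝒢 n`
    (d𝒢 : ℕ → ℕ) (hker𝒢 : ∀ n, (D𝒢.piLevelAut h39𝒢.toProp36Hypotheses.isCountable hconn𝒢 n).ker = charOpenCore (D𝒢.temperedPi h39𝒢.toProp36Hypotheses.isCountable) (d𝒢 n))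
    -- (I0v) for the tower `D𝒢`: every `𝒢_v` acts faithfully on the `v`-fibres of the levels (abc-iut-w4-d053's
    -- `faithfulV_ofOpenNormalSeq` at the prescribed open-normal / characteristic tower)
    (hfaithV𝒢 : ∀ (v : 𝒢.graph.Vertex) (h : 𝒢.Gv v),
      (∀ (n : ℕ) (x : ((D𝒢.S n).SV v).obj.V), ((D𝒢.S n).SV v).obj.ρ h x = x) → h = 1)
    -- `hK1′` REPLACED (the L3 lead's α92 wording): congruence-continuity of `ρ` at the deep tree levels with trivial
    -- base action nearby (`hCC`, Def 5.1 (i)(c)/(d) + Prop 5.2 (i)); `hself` DISCHARGED (abc-iut-w6-d117 p442489)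
    (n𝒢 : ℕ)
    (hCC𝒢 : ∀ n, n𝒢 ≤ n → ∃ U ∈ 𝓝 (1 : ↥𝔊.PA), ∀ a ∈ U, baseAct𝒢 a = 1 ∧
      ∃ φ : contMulAut (D𝒢.chart h39𝒢.toProp36Hypotheses.isCountable hcof𝒢 h39𝒢.toProp36Hypotheses.isConnected hS𝒢 hfin𝒢 hne𝒢).G, TopOut.mk (D𝒢.chart h39𝒢.toProp36Hypotheses.isCountable hcof𝒢 h39𝒢.toProp36Hypotheses.isConnected hS𝒢 hfin𝒢 hne𝒢).G φ = ρ𝒢 a ∧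
        ∀ y : (D𝒢.chart h39𝒢.toProp36Hypotheses.isCountable hcof𝒢 h39𝒢.toProp36Hypotheses.isConnected hS𝒢 hfin𝒢 hne𝒢).G, (φ : MulAut (D𝒢.chart h39𝒢.toProp36Hypotheses.isCountable hcof𝒢 h39𝒢.toProp36Hypotheses.isConnected hS𝒢 hfin𝒢 hne𝒢).G) y * y⁻¹ ∈ (D𝒢.projAut h39𝒢.toProp36Hypotheses.isCountable n).ker)
    -- the topology of `E` IS abc-iut-w6-d070's tempered level topology at the chart of the tower
    (hinst𝒢 : inst𝒢 = @arithLevelTopology 𝒢 (D𝒢.chart h39𝒢.toProp36Hypotheses.isCountable hcof𝒢 h39𝒢.toProp36Hypotheses.isConnected hS𝒢 hfin𝒢 hne𝒢) 𝔊.PA _ _ _ ρ𝒢 baseAct𝒢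
        (TemperedPiChart.firstCountableTopology_G (D𝒢.chart h39𝒢.toProp36Hypotheses.isCountable hcof𝒢 h39𝒢.toProp36Hypotheses.isConnected hS𝒢 hfin𝒢 hne𝒢)) h39𝒢.toProp36Hypotheses IsTempered.of_profinite (D𝒢.piPresentation h39𝒢.toProp36Hypotheses.isCountable T𝒢 R𝒢)
        (isArithCompatible_piPresentation_outerAction_of_branchPair_chart_of_finite D𝒢 h39𝒢.toProp36Hypotheses.isCountable hcof𝒢 h39𝒢.toProp36Hypotheses.isConnected hS𝒢 hfin𝒢 hne𝒢 T𝒢 R𝒢 ρ𝒢 baseAct𝒢 h39𝒢.thm37Hypotheses h39𝒢.isGraph hV𝒢 hBR𝒢) w𝒢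
        (D𝒢.isCompact_piPresentation_H h39𝒢.toProp36Hypotheses.isCountable T𝒢 R𝒢 w𝒢) (fun n => (D𝒢.projAut h39𝒢.toProp36Hypotheses.isCountable n).ker) (fun _ => MonoidHom.normal_ker _)
        (D𝒢.hKst_and_hLst_of_ker_piLevelAut_eq_charOpenCore h39𝒢.toProp36Hypotheses.isCountable hconn𝒢 T𝒢 R𝒢 ρ𝒢 (isArithCompatible_piPresentation_outerAction_of_branchPair_chart_of_finite D𝒢 h39𝒢.toProp36Hypotheses.isCountable hcof𝒢 h39𝒢.toProp36Hypotheses.isConnected hS𝒢 hfin𝒢 hne𝒢 T𝒢 R𝒢 ρ𝒢 baseAct𝒢 h39𝒢.thm37Hypotheses h39𝒢.isGraph hV𝒢 hBR𝒢) d𝒢 hker𝒢).1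
        (D𝒢.ker_projAut_anti h39𝒢.toProp36Hypotheses.isCountable) (D𝒢.isOpen_ker_projAut h39𝒢.toProp36Hypotheses.isCountable) (fun _ hU => D𝒢.exists_ker_projAut_subset h39𝒢.toProp36Hypotheses.isCountable hU)
        (D𝒢.hK1'_chart_of_eventually_congruenceContinuous h39𝒢.thm37Hypotheses hcof𝒢 h39𝒢.toProp36Hypotheses.isConnected hS𝒢 hfin𝒢 hne𝒢 T𝒢 R𝒢 hconn𝒢 ρ𝒢 baseAct𝒢
          (isArithCompatible_piPresentation_outerAction_of_branchPair_chart_of_finite D𝒢 h39𝒢.toProp36Hypotheses.isCountable hcof𝒢 h39𝒢.toProp36Hypotheses.isConnected hS𝒢 hfin𝒢 hne𝒢 T𝒢 R𝒢 ρ𝒢 baseAct𝒢 h39𝒢.thm37Hypotheses h39𝒢.isGraph hV𝒢 hBR𝒢)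
          d𝒢 hker𝒢 h39𝒢.isGraph n𝒢 hCC𝒢))
    (noSwitch𝒢 : NoBranchSwitching 𝒢.graph.edgeOf
      (fun (a : 𝔊.PA) (b : 𝒢.graph.Branch) => (baseAct𝒢 a).hom.branchMap b))
    -- (AI4″) `stabBranchPairAug` REPLACED by the inputs of abc-iut-w4-d059's hcof-FREE
    -- `stabBranchPairAug_chart_outerAction_modKernel` that are NOT terms: only the chart representatives read off the presentation
    (hRcV𝒢 : ∀ v, Rc𝒢.Hv v = (D𝒢.piPresentation h39𝒢.toProp36Hypotheses.isCountable T𝒢 R𝒢).H v)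
    (hRcB𝒢 : ∀ b, Rc𝒢.Hb b = ((D𝒢.piPresentation h39𝒢.toProp36Hypotheses.isCountable T𝒢 R𝒢).M (𝒢.graph.edgeOf b)).map
      (MulAut.conj ((D𝒢.piPresentation h39𝒢.toProp36Hypotheses.isCountable T𝒢 R𝒢).s b)).toMonoidHom)
    (hest𝒢 : IsTotallyArithEstranged (decompositionDataOfChart Rc𝒢 (toOuterSemidirectProduct ρ𝒢)) (outerSemidirectProductSnd ρ𝒢)) (hbot𝒢 : ¬ IsArithAmple (outerSemidirectProductSnd ρ𝒢) ⊥)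
    -- ── the ℍ′ side: a cofinal Galois tower with characteristic levels, its chart, the outer model over `Π_{A′}` ──
    (h39ℋ : Cor39Hypotheses ℋ) (Dℋ : GaloisLevelData ℋ)
    (hcofℋ : ∀ (X : CovObj ℋ), X.IsTempered → ∀ p : X.Point, ∃ i : ℕ, ∀ j, i ≤ j → (Dℋ.S j).Splits (X.component p))
    (hSℋ : ∀ n, (Dℋ.S n).Splits (Dℋ.S n)) (hfinℋ : ∀ n, (Dℋ.S n).IsFinite) (hneℋ : ∀ n, (Dℋ.S n).HasNonemptyFibres)
    (hconnℋ : ∀ (n : ℕ) (p q : (Dℋ.S n).Point), (Dℋ.S n).SameComponent p q)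
    [Finite ℋ.graph.Vertex] [Finite ℋ.graph.Branch]
    [Finite ℋ.graph.Edge]
    (ρℋ : ℍ.PA →* TopOut (Dℋ.chart h39ℋ.toProp36Hypotheses.isCountable hcofℋ h39ℋ.toProp36Hypotheses.isConnected hSℋ hfinℋ hneℋ).G) (baseActℋ : ℍ.PA →* Aut ℋ.graph)
    [instℋ : TopologicalSpace (outerSemidirectProduct ρℋ)]
    (Tℋ : ∀ w : ℋ.graph.Vertex, Dℋ.PointSeq h39ℋ.toProp36Hypotheses.isCountable w) (Rℋ : SemiGraph.RefBranches ℋ.graph)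
    (Rcℋ : ChartRepresentatives (Dℋ.chart h39ℋ.toProp36Hypotheses.isCountable hcofℋ h39ℋ.toProp36Hypotheses.isConnected hSℋ hfinℋ hneℋ))
    -- Prop 3.6 (iv) at `ρ_𝔾(a)` / Def 5.1 (i)(c): the DESIGN data of the outer model (abc-iut-w4-d082's currency)
    (hVℋ : ∀ (a : ℍ.PA) (v : ℋ.graph.Vertex) (H : Subgroup (Dℋ.chart h39ℋ.toProp36Hypotheses.isCountable hcofℋ h39ℋ.toProp36Hypotheses.isConnected hSℋ hfinℋ hneℋ).G), H ∈ verticialSubgroups (Dℋ.chart h39ℋ.toProp36Hypotheses.isCountable hcofℋ h39ℋ.toProp36Hypotheses.isConnected hSℋ hfinℋ hneℋ) v →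
      ∃ φ : contMulAut (Dℋ.chart h39ℋ.toProp36Hypotheses.isCountable hcofℋ h39ℋ.toProp36Hypotheses.isConnected hSℋ hfinℋ hneℋ).G, TopOut.mk _ φ = ρℋ a ∧
        H.map (φ : MulAut (Dℋ.chart h39ℋ.toProp36Hypotheses.isCountable hcofℋ h39ℋ.toProp36Hypotheses.isConnected hSℋ hfinℋ hneℋ).G).toMonoidHom ∈ verticialSubgroups (Dℋ.chart h39ℋ.toProp36Hypotheses.isCountable hcofℋ h39ℋ.toProp36Hypotheses.isConnected hSℋ hfinℋ hneℋ) ((baseActℋ a).hom.vertexMap v))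
    (hEℋ : ∀ (a : ℍ.PA) (e : ℋ.graph.Edge) (K : Subgroup (Dℋ.chart h39ℋ.toProp36Hypotheses.isCountable hcofℋ h39ℋ.toProp36Hypotheses.isConnected hSℋ hfinℋ hneℋ).G), K ∈ edgeLikeSubgroups (Dℋ.chart h39ℋ.toProp36Hypotheses.isCountable hcofℋ h39ℋ.toProp36Hypotheses.isConnected hSℋ hfinℋ hneℋ) e →
      ∃ φ : contMulAut (Dℋ.chart h39ℋ.toProp36Hypotheses.isCountable hcofℋ h39ℋ.toProp36Hypotheses.isConnected hSℋ hfinℋ hneℋ).G, TopOut.mk _ φ = ρℋ a ∧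
        K.map (φ : MulAut (Dℋ.chart h39ℋ.toProp36Hypotheses.isCountable hcofℋ h39ℋ.toProp36Hypotheses.isConnected hSℋ hfinℋ hneℋ).G).toMonoidHom ∈ edgeLikeSubgroups (Dℋ.chart h39ℋ.toProp36Hypotheses.isCountable hcofℋ h39ℋ.toProp36Hypotheses.isConnected hSℋ hfinℋ hneℋ) ((baseActℋ a).hom.edgeMap e))
    (hopenℋ : ∃ U : Subgroup ℍ.PA, IsOpen (U : Set ℍ.PA) ∧ ∀ a ∈ U,
      (∀ v, (baseActℋ a).hom.vertexMap v = v) ∧ (∀ e, (baseActℋ a).hom.edgeMap e = e) ∧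
        ∀ b, (baseActℋ a).hom.branchMap b = b)
    (hBRℋ : ∀ (a : ℍ.PA) (b : ℋ.graph.Branch) (v : ℋ.graph.Vertex) (hb : ℋ.graph.abuts b = some v)
      (φ : ℋ.Gv v →ₜ* (Dℋ.chart h39ℋ.toProp36Hypotheses.isCountable hcofℋ h39ℋ.toProp36Hypotheses.isConnected hSℋ hfinℋ hneℋ).G), IsVerticialHom (Dℋ.chart h39ℋ.toProp36Hypotheses.isCountable hcofℋ h39ℋ.toProp36Hypotheses.isConnected hSℋ hfinℋ hneℋ) v φ →
      ∃ Φ : contMulAut (Dℋ.chart h39ℋ.toProp36Hypotheses.isCountable hcofℋ h39ℋ.toProp36Hypotheses.isConnected hSℋ hfinℋ hneℋ).G, TopOut.mk _ Φ = ρℋ a ∧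
        ∃ φ' : ℋ.Gv ((baseActℋ a).hom.vertexMap v) →ₜ* (Dℋ.chart h39ℋ.toProp36Hypotheses.isCountable hcofℋ h39ℋ.toProp36Hypotheses.isConnected hSℋ hfinℋ hneℋ).G,
          IsVerticialHom (Dℋ.chart h39ℋ.toProp36Hypotheses.isCountable hcofℋ h39ℋ.toProp36Hypotheses.isConnected hSℋ hfinℋ hneℋ) ((baseActℋ a).hom.vertexMap v) φ' ∧
          ∃ x' : (Dℋ.chart h39ℋ.toProp36Hypotheses.isCountable hcofℋ h39ℋ.toProp36Hypotheses.isConnected hSℋ hfinℋ hneℋ).G,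
            Subgroup.map (Φ : MulAut (Dℋ.chart h39ℋ.toProp36Hypotheses.isCountable hcofℋ h39ℋ.toProp36Hypotheses.isConnected hSℋ hfinℋ hneℋ).G).toMonoidHom φ.toMonoidHom.range =
              Subgroup.map (MulAut.conj x').toMonoidHom φ'.toMonoidHom.range ∧
            Subgroup.map (Φ : MulAut (Dℋ.chart h39ℋ.toProp36Hypotheses.isCountable hcofℋ h39ℋ.toProp36Hypotheses.isConnected hSℋ hfinℋ hneℋ).G).toMonoidHom
                (Subgroup.map φ.toMonoidHom (ℋ.branchSubgroup b v hb)) =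
              Subgroup.map (MulAut.conj x').toMonoidHom
                (Subgroup.map φ'.toMonoidHom
                  (ℋ.branchSubgroup ((baseActℋ a).hom.branchMap b) ((baseActℋ a).hom.vertexMap v)
                    ((baseActℋ a).hom.abuts_branchMap b v hb))))
    (wℋ : ℋ.graph.Vertex)
    -- CHARACTERISTIC finite levels (abc-iut-L3-t9 E1): `ker π_n` is the characteristic open core of level `dℋ n`
    (dℋ : ℕ → ℕ) (hkerℋ : ∀ n, (Dℋ.piLevelAut h39ℋ.toProp36Hypotheses.isCountable hconnℋ n).ker = charOpenCore (Dℋ.temperedPi h39ℋ.toProp36Hypotheses.isCountable) (dℋ n))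
    -- (I0v) for the tower `Dℋ`: every `ℋ_v` acts faithfully on the `v`-fibres of the levels (abc-iut-w4-d053's
    -- `faithfulV_ofOpenNormalSeq` at the prescribed open-normal / characteristic tower)
    (hfaithVℋ : ∀ (v : ℋ.graph.Vertex) (h : ℋ.Gv v),
      (∀ (n : ℕ) (x : ((Dℋ.S n).SV v).obj.V), ((Dℋ.S n).SV v).obj.ρ h x = x) → h = 1)
    -- `hK1′` REPLACED (the L3 lead's α92 wording): congruence-continuity of `ρ` at the deep tree levels with trivial
    -- base action nearby (`hCC`, Def 5.1 (i)(c)/(d) + Prop 5.2 (i)); `hself` DISCHARGED (abc-iut-w6-d117 p442489)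
    (nℋ : ℕ)
    (hCCℋ : ∀ n, nℋ ≤ n → ∃ U ∈ 𝓝 (1 : ↥ℍ.PA), ∀ a ∈ U, baseActℋ a = 1 ∧
      ∃ φ : contMulAut (Dℋ.chart h39ℋ.toProp36Hypotheses.isCountable hcofℋ h39ℋ.toProp36Hypotheses.isConnected hSℋ hfinℋ hneℋ).G, TopOut.mk (Dℋ.chart h39ℋ.toProp36Hypotheses.isCountable hcofℋ h39ℋ.toProp36Hypotheses.isConnected hSℋ hfinℋ hneℋ).G φ = ρℋ a ∧
        ∀ y : (Dℋ.chart h39ℋ.toProp36Hypotheses.isCountable hcofℋ h39ℋ.toProp36Hypotheses.isConnected hSℋ hfinℋ hneℋ).G, (φ : MulAut (Dℋ.chart h39ℋ.toProp36Hypotheses.isCountable hcofℋ h39ℋ.toProp36Hypotheses.isConnected hSℋ hfinℋ hneℋ).G) y * y⁻¹ ∈ (Dℋ.projAut h39ℋ.toProp36Hypotheses.isCountable n).ker)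
    -- the topology of `E` IS abc-iut-w6-d070's tempered level topology at the chart of the tower
    (hinstℋ : instℋ = @arithLevelTopology ℋ (Dℋ.chart h39ℋ.toProp36Hypotheses.isCountable hcofℋ h39ℋ.toProp36Hypotheses.isConnected hSℋ hfinℋ hneℋ) ℍ.PA _ _ _ ρℋ baseActℋ
        (TemperedPiChart.firstCountableTopology_G (Dℋ.chart h39ℋ.toProp36Hypotheses.isCountable hcofℋ h39ℋ.toProp36Hypotheses.isConnected hSℋ hfinℋ hneℋ)) h39ℋ.toProp36Hypotheses IsTempered.of_profinite (Dℋ.piPresentation h39ℋ.toProp36Hypotheses.isCountable Tℋ Rℋ)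
        (isArithCompatible_piPresentation_outerAction_of_branchPair_chart_of_finite Dℋ h39ℋ.toProp36Hypotheses.isCountable hcofℋ h39ℋ.toProp36Hypotheses.isConnected hSℋ hfinℋ hneℋ Tℋ Rℋ ρℋ baseActℋ h39ℋ.thm37Hypotheses h39ℋ.isGraph hVℋ hBRℋ) wℋ
        (Dℋ.isCompact_piPresentation_H h39ℋ.toProp36Hypotheses.isCountable Tℋ Rℋ wℋ) (fun n => (Dℋ.projAut h39ℋ.toProp36Hypotheses.isCountable n).ker) (fun _ => MonoidHom.normal_ker _)
        (Dℋ.hKst_and_hLst_of_ker_piLevelAut_eq_charOpenCore h39ℋ.toProp36Hypotheses.isCountable hconnℋ Tℋ Rℋ ρℋ (isArithCompatible_piPresentation_outerAction_of_branchPair_chart_of_finite Dℋ h39ℋ.toProp36Hypotheses.isCountable hcofℋ h39ℋ.toProp36Hypotheses.isConnected hSℋ hfinℋ hneℋ Tℋ Rℋ ρℋ baseActℋ h39ℋ.thm37Hypotheses h39ℋ.isGraph hVℋ hBRℋ) dℋ hkerℋ).1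
        (Dℋ.ker_projAut_anti h39ℋ.toProp36Hypotheses.isCountable) (Dℋ.isOpen_ker_projAut h39ℋ.toProp36Hypotheses.isCountable) (fun _ hU => Dℋ.exists_ker_projAut_subset h39ℋ.toProp36Hypotheses.isCountable hU)
        (Dℋ.hK1'_chart_of_eventually_congruenceContinuous h39ℋ.thm37Hypotheses hcofℋ h39ℋ.toProp36Hypotheses.isConnected hSℋ hfinℋ hneℋ Tℋ Rℋ hconnℋ ρℋ baseActℋ
          (isArithCompatible_piPresentation_outerAction_of_branchPair_chart_of_finite Dℋ h39ℋ.toProp36Hypotheses.isCountable hcofℋ h39ℋ.toProp36Hypotheses.isConnected hSℋ hfinℋ hneℋ Tℋ Rℋ ρℋ baseActℋ h39ℋ.thm37Hypotheses h39ℋ.isGraph hVℋ hBRℋ)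
          dℋ hkerℋ h39ℋ.isGraph nℋ hCCℋ))
    (noSwitchℋ : NoBranchSwitching ℋ.graph.edgeOf
      (fun (a : ℍ.PA) (b : ℋ.graph.Branch) => (baseActℋ a).hom.branchMap b))
    -- (AI4″) `stabBranchPairAug` REPLACED by the inputs of abc-iut-w4-d059's hcof-FREE
    -- `stabBranchPairAug_chart_outerAction_modKernel` that are NOT terms: only the chart representatives read off the presentation
    (hRcVℋ : ∀ v, Rcℋ.Hv v = (Dℋ.piPresentation h39ℋ.toProp36Hypotheses.isCountable Tℋ Rℋ).H v)
    (hRcBℋ : ∀ b, Rcℋ.Hb b = ((Dℋ.piPresentation h39ℋ.toProp36Hypotheses.isCountable Tℋ Rℋ).M (ℋ.graph.edgeOf b)).map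
      (MulAut.conj ((Dℋ.piPresentation h39ℋ.toProp36Hypotheses.isCountable Tℋ Rℋ).s b)).toMonoidHom)
    (hestℋ : IsTotallyArithEstranged (decompositionDataOfChart Rcℋ (toOuterSemidirectProduct ρℋ)) (outerSemidirectProductSnd ρℋ)) (hbotℋ : ¬ IsArithAmple (outerSemidirectProductSnd ρℋ) ⊥)
    -- ── Thm 5.4 (iii): the arithmetic `B^temp`, the dictionary, the represented graph actions (design) ──
    -- (D1)/(D2): the dictionary of arrows with chosen 2-cells and its chart-level representatives (verbatim)
    (dict : (𝔊.G ⟶ ℍ.G) → Hom 𝒢 ℋ) (θd : ∀ g, (dict g).ConjugatorFamily) (hlo : ∀ g, (dict g).IsLocallyOpen)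
    (φc : (𝔊.G ⟶ ℍ.G) → ((D𝒢.chart h39𝒢.toProp36Hypotheses.isCountable hcof𝒢 h39𝒢.toProp36Hypotheses.isConnected hS𝒢 hfin𝒢 hne𝒢).G →ₜ* (Dℋ.chart h39ℋ.toProp36Hypotheses.isCountable hcofℋ h39ℋ.toProp36Hypotheses.isConnected hSℋ hfinℋ hneℋ).G))
    (hφc : ∀ g, Nonempty ((dict g).chartPullbackWith (θd g) (D𝒢.chart h39𝒢.toProp36Hypotheses.isCountable hcof𝒢 h39𝒢.toProp36Hypotheses.isConnected hS𝒢 hfin𝒢 hne𝒢) (Dℋ.chart h39ℋ.toProp36Hypotheses.isCountable hcofℋ h39ℋ.toProp36Hypotheses.isConnected hSℋ hfinℋ hneℋ) ≅ BTemp.res (φc g)))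
    (hfaith : ∀ g₁ g₂ : 𝔊.G ⟶ ℍ.G, Nonempty ((dict g₁).chartPullbackWith (θd g₁) (D𝒢.chart h39𝒢.toProp36Hypotheses.isCountable hcof𝒢 h39𝒢.toProp36Hypotheses.isConnected hS𝒢 hfin𝒢 hne𝒢) (Dℋ.chart h39ℋ.toProp36Hypotheses.isCountable hcofℋ h39ℋ.toProp36Hypotheses.isConnected hSℋ hfinℋ hneℋ) ≅
      (dict g₂).chartPullbackWith (θd g₂) (D𝒢.chart h39𝒢.toProp36Hypotheses.isCountable hcof𝒢 h39𝒢.toProp36Hypotheses.isConnected hS𝒢 hfin𝒢 hne𝒢) (Dℋ.chart h39ℋ.toProp36Hypotheses.isCountable hcofℋ h39ℋ.toProp36Hypotheses.isConnected hSℋ hfinℋ hneℋ)) → g₁ = g₂)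
    (hfull : ∀ F : Hom 𝒢 ℋ, F.IsLocallyOpen → ∀ θ : F.ConjugatorFamily,
      ∃ g : 𝔊.G ⟶ ℍ.G, Nonempty ((dict g).chartPullbackWith (θd g) (D𝒢.chart h39𝒢.toProp36Hypotheses.isCountable hcof𝒢 h39𝒢.toProp36Hypotheses.isConnected hS𝒢 hfin𝒢 hne𝒢) (Dℋ.chart h39ℋ.toProp36Hypotheses.isCountable hcofℋ h39ℋ.toProp36Hypotheses.isConnected hSℋ hfinℋ hneℋ) ≅ F.chartPullbackWith θ (D𝒢.chart h39𝒢.toProp36Hypotheses.isCountable hcof𝒢 h39𝒢.toProp36Hypotheses.isConnected hS𝒢 hfin𝒢 hne𝒢) (Dℋ.chart h39ℋ.toProp36Hypotheses.isCountable hcofℋ h39ℋ.toProp36Hypotheses.isConnected hSℋ hfinℋ hneℋ)))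
    -- (D1a)/(D1b): the graph actions of `Π_A` on `𝔾` and of `Π_{A′}` on `ℍ′` with chosen 2-cells, REPRESENTED at
    -- the outer actions (abc-iut-w5-d141's `hrep` currency), and the functoriality of the dictionary
    (F𝒢 : 𝔊.PA → Hom 𝒢 𝒢) (θ𝒢 : ∀ a, (F𝒢 a).ConjugatorFamily)
    (hrep𝒢 : ∀ a, ∃ (Φ : contMulAut (D𝒢.chart h39𝒢.toProp36Hypotheses.isCountable hcof𝒢 h39𝒢.toProp36Hypotheses.isConnected hS𝒢 hfin𝒢 hne𝒢).G) (φ : (D𝒢.chart h39𝒢.toProp36Hypotheses.isCountable hcof𝒢 h39𝒢.toProp36Hypotheses.isConnected hS𝒢 hfin𝒢 hne𝒢).G →ₜ* (D𝒢.chart h39𝒢.toProp36Hypotheses.isCountable hcof𝒢 h39𝒢.toProp36Hypotheses.isConnected hS𝒢 hfin𝒢 hne𝒢).G), TopOut.mk (D𝒢.chart h39𝒢.toProp36Hypotheses.isCountable hcof𝒢 h39𝒢.toProp36Hypotheses.isConnected hS𝒢 hfin𝒢 hne𝒢).G Φ = ρ𝒢 a ∧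
      (∀ t, (Φ : MulAut (D𝒢.chart h39𝒢.toProp36Hypotheses.isCountable hcof𝒢 h39𝒢.toProp36Hypotheses.isConnected hS𝒢 hfin𝒢 hne𝒢).G) t = φ t) ∧ Nonempty ((F𝒢 a).chartPullbackWith (θ𝒢 a) (D𝒢.chart h39𝒢.toProp36Hypotheses.isCountable hcof𝒢 h39𝒢.toProp36Hypotheses.isConnected hS𝒢 hfin𝒢 hne𝒢) (D𝒢.chart h39𝒢.toProp36Hypotheses.isCountable hcof𝒢 h39𝒢.toProp36Hypotheses.isConnected hS𝒢 hfin𝒢 hne𝒢) ≅ BTemp.res φ))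
    (hpre : ∀ (a : 𝔊.PA) (g : 𝔊.G ⟶ ℍ.G),
      Nonempty ((dict ((𝔊.ρ a).hom ≫ g)).chartPullbackWith (θd ((𝔊.ρ a).hom ≫ g)) (D𝒢.chart h39𝒢.toProp36Hypotheses.isCountable hcof𝒢 h39𝒢.toProp36Hypotheses.isConnected hS𝒢 hfin𝒢 hne𝒢) (Dℋ.chart h39ℋ.toProp36Hypotheses.isCountable hcofℋ h39ℋ.toProp36Hypotheses.isConnected hSℋ hfinℋ hneℋ) ≅
        (dict g).chartPullbackWith (θd g) (D𝒢.chart h39𝒢.toProp36Hypotheses.isCountable hcof𝒢 h39𝒢.toProp36Hypotheses.isConnected hS𝒢 hfin𝒢 hne𝒢) (Dℋ.chart h39ℋ.toProp36Hypotheses.isCountable hcofℋ h39ℋ.toProp36Hypotheses.isConnected hSℋ hfinℋ hneℋ) ⋙ (F𝒢 a).chartPullbackWith (θ𝒢 a) (D𝒢.chart h39𝒢.toProp36Hypotheses.isCountable hcof𝒢 h39𝒢.toProp36Hypotheses.isConnected hS𝒢 hfin𝒢 hne𝒢) (D𝒢.chart h39𝒢.toProp36Hypotheses.isCountable hcof𝒢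 h39𝒢.toProp36Hypotheses.isConnected hS𝒢 hfin𝒢 hne𝒢)))
    (Fℋ : ℍ.PA → Hom ℋ ℋ) (θℋ : ∀ a, (Fℋ a).ConjugatorFamily)
    (hrepℋ : ∀ a, ∃ (Φ : contMulAut (Dℋ.chart h39ℋ.toProp36Hypotheses.isCountable hcofℋ h39ℋ.toProp36Hypotheses.isConnected hSℋ hfinℋ hneℋ).G) (φ : (Dℋ.chart h39ℋ.toProp36Hypotheses.isCountable hcofℋ h39ℋ.toProp36Hypotheses.isConnected hSℋ hfinℋ hneℋ).G →ₜ* (Dℋ.chart h39ℋ.toProp36Hypotheses.isCountable hcofℋ h39ℋ.toProp36Hypotheses.isConnected hSℋ hfinℋ hneℋ).G), TopOut.mk (Dℋ.chart h39ℋ.toProp36Hypotheses.isCountable hcofℋ h39ℋ.toProp36Hypotheses.isConnected hSℋ hfinℋ hneℋ).G Φ = ρℋ a ∧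
      (∀ t, (Φ : MulAut (Dℋ.chart h39ℋ.toProp36Hypotheses.isCountable hcofℋ h39ℋ.toProp36Hypotheses.isConnected hSℋ hfinℋ hneℋ).G) t = φ t) ∧ Nonempty ((Fℋ a).chartPullbackWith (θℋ a) (Dℋ.chart h39ℋ.toProp36Hypotheses.isCountable hcofℋ h39ℋ.toProp36Hypotheses.isConnected hSℋ hfinℋ hneℋ) (Dℋ.chart h39ℋ.toProp36Hypotheses.isCountable hcofℋ h39ℋ.toProp36Hypotheses.isConnected hSℋ hfinℋ hneℋ) ≅ BTemp.res φ))
    (hpost : ∀ (a : ℍ.PA) (g : 𝔊.G ⟶ ℍ.G),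
      Nonempty ((dict (g ≫ (ℍ.ρ a).hom)).chartPullbackWith (θd (g ≫ (ℍ.ρ a).hom)) (D𝒢.chart h39𝒢.toProp36Hypotheses.isCountable hcof𝒢 h39𝒢.toProp36Hypotheses.isConnected hS𝒢 hfin𝒢 hne𝒢) (Dℋ.chart h39ℋ.toProp36Hypotheses.isCountable hcofℋ h39ℋ.toProp36Hypotheses.isConnected hSℋ hfinℋ hneℋ) ≅
        (Fℋ a).chartPullbackWith (θℋ a) (Dℋ.chart h39ℋ.toProp36Hypotheses.isCountable hcofℋ h39ℋ.toProp36Hypotheses.isConnected hSℋ hfinℋ hneℋ) (Dℋ.chart h39ℋ.toProp36Hypotheses.isCountable hcofℋ h39ℋ.toProp36Hypotheses.isConnected hSℋ hfinℋ hneℋ) ⋙ (dict g).chartPullbackWith (θd g) (D𝒢.chart h39𝒢.toProp36Hypotheses.isCountable hcof𝒢 h39𝒢.toProp36Hypotheses.isConnected hS𝒢 hfin𝒢 hne𝒢) (Dℋ.chart h39ℋ.toProp36Hypotheses.isCountable hcofℋ h39ℋ.toProp36Hypotheses.isConnected hSℋ hfinℋ hneℋ)))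
    -- the arithmetic `B^temp` on the geometric part, chart currency (verbatim, kernel of `aug_ℍ` natively)
    -- `B^temp(φ)` CANONICAL (abc-iut-w4-d053 p439273) with BOTH inputs TERMS (`compat_of_representatives ∘
    -- btemp_representatives_of_dict` p441630; `centraliserFree_of_chartPullbackWith_iso` p440786); ONE law left — continuity:
    (hcont : ∀ (φ : ArithHom 𝓥 𝔊 ℍ) (_h₁ : φ.IsLocallyOpen) (h₂ : ArithHom.IsOverA 𝔊 ℍ e φ),
      Continuous (outerSemidirectProductMap ρ𝒢 ρℋ e.toMonoidHom (φc φ.geom).toMonoidHom (compat_of_representatives ρ𝒢 ρℋ e.toMonoidHom (φc φ.geom).toMonoidHom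
          (btemp_representatives_of_dict (D𝒢.chart h39𝒢.toProp36Hypotheses.isCountable hcof𝒢 h39𝒢.toProp36Hypotheses.isConnected hS𝒢 hfin𝒢 hne𝒢) (Dℋ.chart h39ℋ.toProp36Hypotheses.isCountable hcofℋ h39ℋ.toProp36Hypotheses.isConnected hSℋ hfinℋ hneℋ) ρ𝒢 ρℋ e.toMonoidHom F𝒢 θ𝒢 (fun a => Fℋ (e a)) (fun a => θℋ (e a))
            hrep𝒢 (fun a => hrepℋ (e a)) dict θd φc hφc (fun a g => (𝔊.ρ a).hom ≫ g) (fun a g => g ≫ (ℍ.ρ (e a)).hom)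
            hpre (fun a g => hpost (e a) g) φ.geom (fun a => (φ.compat a).trans (by rw [h₂ a]))))
        (centraliserFree_of_chartPullbackWith_iso h39𝒢.thm37Hypotheses h39ℋ.thm37Hypotheses (D𝒢.chart h39𝒢.toProp36Hypotheses.isCountable hcof𝒢 h39𝒢.toProp36Hypotheses.isConnected hS𝒢 hfin𝒢 hne𝒢) (Dℋ.chart h39ℋ.toProp36Hypotheses.isCountable hcofℋ h39ℋ.toProp36Hypotheses.isConnected hSℋ hfinℋ hneℋ) (dict φ.geom) (θd φ.geom) (hlo φ.geom) (φc φ.geom) (hφc φ.geom))))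
    (he : Continuous e) :
    (ArithMaximalCompactStatementI (decompositionDataOfChart Rc𝒢 (toOuterSemidirectProduct ρ𝒢)) (outerSemidirectProductSnd ρ𝒢) ∧
      ArithMaximalCompactStatementII (decompositionDataOfChart Rc𝒢 (toOuterSemidirectProduct ρ𝒢)) (outerSemidirectProductSnd ρ𝒢)) ∧
    (ArithMaximalCompactStatementI (decompositionDataOfChart Rcℋ (toOuterSemidirectProduct ρℋ)) (outerSemidirectProductSnd ρℋ) ∧
      ArithMaximalCompactStatementII (decompositionDataOfChart Rcℋ (toOuterSemidirectProduct ρℋ)) (outerSemidirectProductSnd ρℋ)) ∧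
    Literature.AnabelianGeometry.SemiGraphs.ArithQuasiGeometricCorrespondenceStatementCompat 𝔊 ℍ e
      (outerSemidirectProductSnd ρ𝒢) (outerSemidirectProductSnd ρℋ)
      (fun φ _ h₂ => outerSemidirectProductMap ρ𝒢 ρℋ e.toMonoidHom (φc φ.geom).toMonoidHom (compat_of_representatives ρ𝒢 ρℋ e.toMonoidHom (φc φ.geom).toMonoidHom
          (btemp_representatives_of_dict (D𝒢.chart h39𝒢.toProp36Hypotheses.isCountable hcof𝒢 h39𝒢.toProp36Hypotheses.isConnected hS𝒢 hfin𝒢 hne𝒢) (Dℋ.chart h39ℋ.toProp36Hypotheses.isCountable hcofℋ h39ℋ.toProp36Hypotheses.isConnected hSℋ hfinℋ hneℋ) ρ𝒢 ρℋ e.toMonoidHom F𝒢 θ𝒢 (fun a => Fℋ (e a)) (fun a => θℋ (e a))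
            hrep𝒢 (fun a => hrepℋ (e a)) dict θd φc hφc (fun a g => (𝔊.ρ a).hom ≫ g) (fun a g => g ≫ (ℍ.ρ (e a)).hom)
            hpre (fun a g => hpost (e a) g) φ.geom (fun a => (φ.compat a).trans (by rw [h₂ a])))) (centraliserFree_of_chartPullbackWith_iso h39𝒢.thm37Hypotheses h39ℋ.thm37Hypotheses (D𝒢.chart h39𝒢.toProp36Hypotheses.isCountable hcof𝒢 h39𝒢.toProp36Hypotheses.isConnected hS𝒢 hfin𝒢 hne𝒢) (Dℋ.chart h39ℋ.toProp36Hypotheses.isCountable hcofℋ h39ℋ.toProp36Hypotheses.isConnected hSℋ hfinℋ hneℋ) (dict φ.geom) (θd φ.geom) (hlo φ.geom) (φc φ.geom) (hφc φ.geom))) := by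
  -- `σ ∘ ι = 1` at both outer models (exactness, temp-slimness)
  have hισ𝒢 : ∀ g : (D𝒢.chart h39𝒢.toProp36Hypotheses.isCountable hcof𝒢 h39𝒢.toProp36Hypotheses.isConnected hS𝒢 hfin𝒢 hne𝒢).G, (baseAct𝒢.comp (outerSemidirectProductSnd ρ𝒢)) ((toOuterSemidirectProduct ρ𝒢) g) = 1 :=
    fun g => by
      obtain ⟨-, hex, -⟩ := outerAction_exact (D𝒢.chart h39𝒢.toProp36Hypotheses.isCountable hcof𝒢 h39𝒢.toProp36Hypotheses.isConnected hS𝒢 hfin𝒢 hne𝒢) ρ𝒢 h39𝒢.toProp36Hypotheses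
      have hg : (toOuterSemidirectProduct ρ𝒢) g ∈ (outerSemidirectProductSnd ρ𝒢).ker := hex ▸ ⟨g, rfl⟩
      rw [MonoidHom.comp_apply, (MonoidHom.mem_ker).mp hg, map_one]
  have hισℋ : ∀ g : (Dℋ.chart h39ℋ.toProp36Hypotheses.isCountable hcofℋ h39ℋ.toProp36Hypotheses.isConnected hSℋ hfinℋ hneℋ).G, (baseActℋ.comp (outerSemidirectProductSnd ρℋ)) ((toOuterSemidirectProduct ρℋ) g) = 1 :=
    fun g => by
      obtain ⟨-, hex, -⟩ := outerAction_exact (Dℋ.chart h39ℋ.toProp36Hypotheses.isCountable hcofℋ h39ℋ.toProp36Hypotheses.isConnected hSℋ hfinℋ hneℋ) ρℋ h39ℋ.toProp36Hypotheses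
      have hg : (toOuterSemidirectProduct ρℋ) g ∈ (outerSemidirectProductSnd ρℋ).ker := hex ▸ ⟨g, rfl⟩
      rw [MonoidHom.comp_apply, (MonoidHom.mem_ker).mp hg, map_one]
  -- the two topology pins
  subst hinst𝒢 hinstℋ
  have hP𝒢' := isArithCompatible_piPresentation_outerAction_of_branchPair_chart_of_finite D𝒢 h39𝒢.toProp36Hypotheses.isCountable hcof𝒢 h39𝒢.toProp36Hypotheses.isConnected hS𝒢 hfin𝒢 hne𝒢 T𝒢 R𝒢 ρ𝒢 baseAct𝒢 h39𝒢.thm37Hypotheses h39𝒢.isGraph hV𝒢 hBR𝒢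
  have hKL𝒢' := D𝒢.hKst_and_hLst_of_ker_piLevelAut_eq_charOpenCore h39𝒢.toProp36Hypotheses.isCountable hconn𝒢 T𝒢 R𝒢 ρ𝒢 hP𝒢' d𝒢 hker𝒢
  have hK1𝒢' := D𝒢.hK1'_chart_of_eventually_congruenceContinuous h39𝒢.thm37Hypotheses hcof𝒢 h39𝒢.toProp36Hypotheses.isConnected hS𝒢 hfin𝒢 hne𝒢 T𝒢 R𝒢 hconn𝒢 ρ𝒢 baseAct𝒢
    hP𝒢' d𝒢 hker𝒢 h39𝒢.isGraph n𝒢 hCC𝒢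
  have hcpt𝒢' := D𝒢.isCompact_piPresentation_H h39𝒢.toProp36Hypotheses.isCountable T𝒢 R𝒢 w𝒢
  have hPℋ' := isArithCompatible_piPresentation_outerAction_of_branchPair_chart_of_finite Dℋ h39ℋ.toProp36Hypotheses.isCountable hcofℋ h39ℋ.toProp36Hypotheses.isConnected hSℋ hfinℋ hneℋ Tℋ Rℋ ρℋ baseActℋ h39ℋ.thm37Hypotheses h39ℋ.isGraph hVℋ hBRℋ
  have hKLℋ' := Dℋ.hKst_and_hLst_of_ker_piLevelAut_eq_charOpenCore h39ℋ.toProp36Hypotheses.isCountable hconnℋ Tℋ Rℋ ρℋ hPℋ' dℋ hkerℋ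
  have hK1ℋ' := Dℋ.hK1'_chart_of_eventually_congruenceContinuous h39ℋ.thm37Hypotheses hcofℋ h39ℋ.toProp36Hypotheses.isConnected hSℋ hfinℋ hneℋ Tℋ Rℋ hconnℋ ρℋ baseActℋ
    hPℋ' dℋ hkerℋ h39ℋ.isGraph nℋ hCCℋ
  have hcptℋ' := Dℋ.isCompact_piPresentation_H h39ℋ.toProp36Hypotheses.isCountable Tℋ Rℋ wℋ
  haveI hfc𝒢 : FirstCountableTopology (D𝒢.chart h39𝒢.toProp36Hypotheses.isCountable hcof𝒢 h39𝒢.toProp36Hypotheses.isConnected hS𝒢 hfin𝒢 hne𝒢).G := TemperedPiChart.firstCountableTopology_G _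
  haveI hfcℋ : FirstCountableTopology (Dℋ.chart h39ℋ.toProp36Hypotheses.isCountable hcofℋ h39ℋ.toProp36Hypotheses.isConnected hSℋ hfinℋ hneℋ).G := TemperedPiChart.firstCountableTopology_G _
  letI : TopologicalSpace (outerSemidirectProduct ρ𝒢) := arithLevelTopology (D𝒢.chart h39𝒢.toProp36Hypotheses.isCountable hcof𝒢 h39𝒢.toProp36Hypotheses.isConnected hS𝒢 hfin𝒢 hne𝒢) ρ𝒢 baseAct𝒢 h39𝒢.toProp36Hypotheses IsTempered.of_profinite (D𝒢.piPresentation h39𝒢.toProp36Hypotheses.isCountable T𝒢 R𝒢) hP𝒢' w𝒢 hcpt𝒢'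
      (fun n => (D𝒢.projAut h39𝒢.toProp36Hypotheses.isCountable n).ker) (fun _ => MonoidHom.normal_ker _) hKL𝒢'.1 (D𝒢.ker_projAut_anti h39𝒢.toProp36Hypotheses.isCountable)
      (D𝒢.isOpen_ker_projAut h39𝒢.toProp36Hypotheses.isCountable) (fun _ hU => D𝒢.exists_ker_projAut_subset h39𝒢.toProp36Hypotheses.isCountable hU) hK1𝒢'
  letI : TopologicalSpace (outerSemidirectProduct ρℋ) := arithLevelTopology (Dℋ.chart h39ℋ.toProp36Hypotheses.isCountable hcofℋ h39ℋ.toProp36Hypotheses.isConnected hSℋ hfinℋ hneℋ) ρℋ baseActℋ h39ℋ.toProp36Hypotheses IsTempered.of_profinite (Dℋ.piPresentation h39ℋ.toProp36Hypotheses.isCountable Tℋ Rℋ) hPℋ' wℋ hcptℋ'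
      (fun n => (Dℋ.projAut h39ℋ.toProp36Hypotheses.isCountable n).ker) (fun _ => MonoidHom.normal_ker _) hKLℋ'.1 (Dℋ.ker_projAut_anti h39ℋ.toProp36Hypotheses.isCountable)
      (Dℋ.isOpen_ker_projAut h39ℋ.toProp36Hypotheses.isCountable) (fun _ hU => Dℋ.exists_ker_projAut_subset h39ℋ.toProp36Hypotheses.isCountable hU) hK1ℋ'
  haveI := arithLevelTopology_isTopologicalGroup (D𝒢.chart h39𝒢.toProp36Hypotheses.isCountable hcof𝒢 h39𝒢.toProp36Hypotheses.isConnected hS𝒢 hfin𝒢 hne𝒢) ρ𝒢 baseAct𝒢 h39𝒢.toProp36Hypotheses IsTempered.of_profinite (D𝒢.piPresentation h39𝒢.toProp36Hypotheses.isCountable T𝒢 R𝒢) hP𝒢' w𝒢 hcpt𝒢'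
      (fun n => (D𝒢.projAut h39𝒢.toProp36Hypotheses.isCountable n).ker) (fun _ => MonoidHom.normal_ker _) hKL𝒢'.1 (D𝒢.ker_projAut_anti h39𝒢.toProp36Hypotheses.isCountable)
      (D𝒢.isOpen_ker_projAut h39𝒢.toProp36Hypotheses.isCountable) (fun _ hU => D𝒢.exists_ker_projAut_subset h39𝒢.toProp36Hypotheses.isCountable hU) hK1𝒢'
  haveI := arithLevelTopology_isTopologicalGroup (Dℋ.chart h39ℋ.toProp36Hypotheses.isCountable hcofℋ h39ℋ.toProp36Hypotheses.isConnected hSℋ hfinℋ hneℋ) ρℋ baseActℋ h39ℋ.toProp36Hypotheses IsTempered.of_profinite (Dℋ.piPresentation h39ℋ.toProp36Hypotheses.isCountable Tℋ Rℋ) hPℋ' wℋ hcptℋ'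
      (fun n => (Dℋ.projAut h39ℋ.toProp36Hypotheses.isCountable n).ker) (fun _ => MonoidHom.normal_ker _) hKLℋ'.1 (Dℋ.ker_projAut_anti h39ℋ.toProp36Hypotheses.isCountable)
      (Dℋ.isOpen_ker_projAut h39ℋ.toProp36Hypotheses.isCountable) (fun _ hU => Dℋ.exists_ker_projAut_subset h39ℋ.toProp36Hypotheses.isCountable hU) hK1ℋ'
  -- kernel normality at the chart's group structure (instance pin, as in p442253)
  haveI : ∀ n : ℕ, @Subgroup.Normal (D𝒢.chart h39𝒢.toProp36Hypotheses.isCountable hcof𝒢 h39𝒢.toProp36Hypotheses.isConnected hS𝒢 hfin𝒢 hne𝒢).G (D𝒢.chart h39𝒢.toProp36Hypotheses.isCountable hcof𝒢 h39𝒢.toProp36Hypotheses.isConnected hS𝒢 hfin𝒢 hne𝒢).group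
      ((D𝒢.projAut h39𝒢.toProp36Hypotheses.isCountable n).ker) := fun _ => MonoidHom.normal_ker _
  haveI : ∀ n : ℕ, @Subgroup.Normal (D𝒢.chart h39𝒢.toProp36Hypotheses.isCountable hcof𝒢 h39𝒢.toProp36Hypotheses.isConnected hS𝒢 hfin𝒢 hne𝒢).G (D𝒢.chart h39𝒢.toProp36Hypotheses.isCountable hcof𝒢 h39𝒢.toProp36Hypotheses.isConnected hS𝒢 hfin𝒢 hne𝒢).group
      ((D𝒢.piLevelAut h39𝒢.toProp36Hypotheses.isCountable hconn𝒢 n).ker) := fun _ => MonoidHom.normal_ker _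
  haveI : ∀ n : ℕ, @Subgroup.Normal (Dℋ.chart h39ℋ.toProp36Hypotheses.isCountable hcofℋ h39ℋ.toProp36Hypotheses.isConnected hSℋ hfinℋ hneℋ).G (Dℋ.chart h39ℋ.toProp36Hypotheses.isCountable hcofℋ h39ℋ.toProp36Hypotheses.isConnected hSℋ hfinℋ hneℋ).group
      ((Dℋ.projAut h39ℋ.toProp36Hypotheses.isCountable n).ker) := fun _ => MonoidHom.normal_ker _
  haveI : ∀ n : ℕ, @Subgroup.Normal (Dℋ.chart h39ℋ.toProp36Hypotheses.isCountable hcofℋ h39ℋ.toProp36Hypotheses.isConnected hSℋ hfinℋ hneℋ).G (Dℋ.chart h39ℋ.toProp36Hypotheses.isCountable hcofℋ h39ℋ.toProp36Hypotheses.isConnected hSℋ hfinℋ hneℋ).group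
      ((Dℋ.piLevelAut h39ℋ.toProp36Hypotheses.isCountable hconnℋ n).ker) := fun _ => MonoidHom.normal_ker _
  -- (AI4″) on both sides (abc-iut-w4-d059)
  have stab𝒢 := (stabBranchPairAug_chart_outerAction_modKernel D𝒢 h39𝒢.toProp36Hypotheses.isCountable hcof𝒢 h39𝒢.toProp36Hypotheses.isConnected hS𝒢 hfin𝒢 hne𝒢 hconn𝒢
      h39𝒢.thm37Hypotheses T𝒢 R𝒢 ρ𝒢 baseAct𝒢 hP𝒢' hKL𝒢'.2
      (continuous_outerSemidirectProductSnd (D𝒢.chart h39𝒢.toProp36Hypotheses.isCountable hcof𝒢 h39𝒢.toProp36Hypotheses.isConnected hS𝒢 hfin𝒢 hne𝒢) ρ𝒢 baseAct𝒢 h39𝒢.toProp36Hypotheses IsTempered.of_profinite (D𝒢.piPresentation h39𝒢.toProp36Hypotheses.isCountable T𝒢 R𝒢) hP𝒢' w𝒢 hcpt𝒢'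
      (fun n => (D𝒢.projAut h39𝒢.toProp36Hypotheses.isCountable n).ker) (fun _ => MonoidHom.normal_ker _) hKL𝒢'.1 (D𝒢.ker_projAut_anti h39𝒢.toProp36Hypotheses.isCountable)
      (D𝒢.isOpen_ker_projAut h39𝒢.toProp36Hypotheses.isCountable) (fun _ hU => D𝒢.exists_ker_projAut_subset h39𝒢.toProp36Hypotheses.isCountable hU) hK1𝒢')
      Rc𝒢 hRcV𝒢 hRcB𝒢
      (fun n => isOpen_ker_arithAct_of_le (D𝒢.chart h39𝒢.toProp36Hypotheses.isCountable hcof𝒢 h39𝒢.toProp36Hypotheses.isConnected hS𝒢 hfin𝒢 hne𝒢) ρ𝒢 baseAct𝒢 h39𝒢.toProp36Hypotheses IsTempered.of_profinite (D𝒢.piPresentation h39𝒢.toProp36Hypotheses.isCountable T𝒢 R𝒢) hP𝒢' w𝒢 hcpt𝒢'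
      (fun n => (D𝒢.projAut h39𝒢.toProp36Hypotheses.isCountable n).ker) (fun _ => MonoidHom.normal_ker _) hKL𝒢'.1 (D𝒢.ker_projAut_anti h39𝒢.toProp36Hypotheses.isCountable)
      (D𝒢.isOpen_ker_projAut h39𝒢.toProp36Hypotheses.isCountable) (fun _ hU => D𝒢.exists_ker_projAut_subset h39𝒢.toProp36Hypotheses.isCountable hU) hK1𝒢'
        (hKL𝒢'.2 n) (D𝒢.ker_projAut_le_ker_piLevelAut h39𝒢.toProp36Hypotheses.isCountable hconn𝒢 n))
      (hVc_of_cosetTower (D𝒢.chart h39𝒢.toProp36Hypotheses.isCountable hcof𝒢 h39𝒢.toProp36Hypotheses.isConnected hS𝒢 hfin𝒢 hne𝒢) (D𝒢.piPresentation h39𝒢.toProp36Hypotheses.isCountable T𝒢 R𝒢) hP𝒢' (toOuterSemidirectProduct ρ𝒢) (outerAction_exact (D𝒢.chart h39𝒢.toProp36Hypotheses.isCountable hcof𝒢 h39𝒢.toProp36Hypotheses.isConnected hS𝒢 hfin𝒢 hne𝒢) ρ𝒢 h39𝒢.toProp36Hypotheses).1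
        (fun e x => conj_toOuterSemidirectProduct ρ𝒢 e x) (fun _ => rfl) hισ𝒢
        (fun w' => by
        rw [D𝒢.piPresentation_H h39𝒢.toProp36Hypotheses.isCountable T𝒢 R𝒢]
        exact (T𝒢 w').range_decompHom_mem_verticialSubgroups_chart hcof𝒢 h39𝒢.toProp36Hypotheses.isConnected hS𝒢 hfin𝒢 hne𝒢)
        Rc𝒢 hRcV𝒢 (fun n => (D𝒢.projAut h39𝒢.toProp36Hypotheses.isCountable n).ker) hKL𝒢'.1
        (D𝒢.piPresentation_hHK h39𝒢.toProp36Hypotheses.isCountable T𝒢 R𝒢) h39𝒢.thm37Hypotheses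
        (isOpen_ker_arithAct (D𝒢.chart h39𝒢.toProp36Hypotheses.isCountable hcof𝒢 h39𝒢.toProp36Hypotheses.isConnected hS𝒢 hfin𝒢 hne𝒢) ρ𝒢 baseAct𝒢 h39𝒢.toProp36Hypotheses IsTempered.of_profinite (D𝒢.piPresentation h39𝒢.toProp36Hypotheses.isCountable T𝒢 R𝒢) hP𝒢' w𝒢 hcpt𝒢'
      (fun n => (D𝒢.projAut h39𝒢.toProp36Hypotheses.isCountable n).ker) (fun _ => MonoidHom.normal_ker _) hKL𝒢'.1 (D𝒢.ker_projAut_anti h39𝒢.toProp36Hypotheses.isCountable)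
      (D𝒢.isOpen_ker_projAut h39𝒢.toProp36Hypotheses.isCountable) (fun _ hU => D𝒢.exists_ker_projAut_subset h39𝒢.toProp36Hypotheses.isCountable hU) hK1𝒢')
        (isTempered_arithLevelTopology (D𝒢.chart h39𝒢.toProp36Hypotheses.isCountable hcof𝒢 h39𝒢.toProp36Hypotheses.isConnected hS𝒢 hfin𝒢 hne𝒢) ρ𝒢 baseAct𝒢 h39𝒢.toProp36Hypotheses IsTempered.of_profinite (D𝒢.piPresentation h39𝒢.toProp36Hypotheses.isCountable T𝒢 R𝒢) hP𝒢' w𝒢 hcpt𝒢'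
      (fun n => (D𝒢.projAut h39𝒢.toProp36Hypotheses.isCountable n).ker) (fun _ => MonoidHom.normal_ker _) hKL𝒢'.1 (D𝒢.ker_projAut_anti h39𝒢.toProp36Hypotheses.isCountable)
      (D𝒢.isOpen_ker_projAut h39𝒢.toProp36Hypotheses.isCountable) (fun _ hU => D𝒢.exists_ker_projAut_subset h39𝒢.toProp36Hypotheses.isCountable hU) hK1𝒢')
        (outerSemidirectProductSnd ρ𝒢)
        (arithLevelTopology_nhds_hasBasis (D𝒢.chart h39𝒢.toProp36Hypotheses.isCountable hcof𝒢 h39𝒢.toProp36Hypotheses.isConnected hS𝒢 hfin𝒢 hne𝒢) ρ𝒢 baseAct𝒢 h39𝒢.toProp36Hypotheses IsTempered.of_profinite (D𝒢.piPresentation h39𝒢.toProp36Hypotheses.isCountable T𝒢 R𝒢) hP𝒢' w𝒢 hcpt𝒢'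
      (fun n => (D𝒢.projAut h39𝒢.toProp36Hypotheses.isCountable n).ker) (fun _ => MonoidHom.normal_ker _) hKL𝒢'.1 (D𝒢.ker_projAut_anti h39𝒢.toProp36Hypotheses.isCountable)
      (D𝒢.isOpen_ker_projAut h39𝒢.toProp36Hypotheses.isCountable) (fun _ hU => D𝒢.exists_ker_projAut_subset h39𝒢.toProp36Hypotheses.isCountable hU) hK1𝒢')
        (le_of_eq (outerAction_exact (D𝒢.chart h39𝒢.toProp36Hypotheses.isCountable hcof𝒢 h39𝒢.toProp36Hypotheses.isConnected hS𝒢 hfin𝒢 hne𝒢) ρ𝒢 h39𝒢.toProp36Hypotheses).2.1.symm)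
        hK1𝒢'
        (D𝒢.isOpen_ker_projAut h39𝒢.toProp36Hypotheses.isCountable))
      (fun n => isClosed_map_ker_arithAct_arithLevelTopology (D𝒢.chart h39𝒢.toProp36Hypotheses.isCountable hcof𝒢 h39𝒢.toProp36Hypotheses.isConnected hS𝒢 hfin𝒢 hne𝒢) ρ𝒢 baseAct𝒢 (D𝒢.piPresentation h39𝒢.toProp36Hypotheses.isCountable T𝒢 R𝒢) hP𝒢' h39𝒢.toProp36Hypotheses IsTempered.of_profinite w𝒢 hcpt𝒢'
      (fun n => (D𝒢.projAut h39𝒢.toProp36Hypotheses.isCountable n).ker) (fun _ => MonoidHom.normal_ker _) hKL𝒢'.1 (D𝒢.ker_projAut_anti h39𝒢.toProp36Hypotheses.isCountable)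
      (D𝒢.isOpen_ker_projAut h39𝒢.toProp36Hypotheses.isCountable) (fun _ hU => D𝒢.exists_ker_projAut_subset h39𝒢.toProp36Hypotheses.isCountable hU) hK1𝒢'
        (hKL𝒢'.2 n) (D𝒢.ker_projAut_le_ker_piLevelAut h39𝒢.toProp36Hypotheses.isCountable hconn𝒢 n))
      (fun v₀ a ha => hU_arithVertGp_outerAction (D𝒢.chart h39𝒢.toProp36Hypotheses.isCountable hcof𝒢 h39𝒢.toProp36Hypotheses.isConnected hS𝒢 hfin𝒢 hne𝒢) ρ𝒢 baseAct𝒢 (D𝒢.piPresentation h39𝒢.toProp36Hypotheses.isCountable T𝒢 R𝒢) hP𝒢' (outerAction_exact (D𝒢.chart h39𝒢.toProp36Hypotheses.isCountable hcof𝒢 h39𝒢.toProp36Hypotheses.isConnected hS𝒢 hfin𝒢 hne𝒢) ρ𝒢 h39𝒢.toProp36Hypotheses).2.1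
        (fun n => (D𝒢.projAut h39𝒢.toProp36Hypotheses.isCountable n).ker)
        (D𝒢.ker_projAut_anti h39𝒢.toProp36Hypotheses.isCountable) hKL𝒢'.1
        (D𝒢.piPresentation_hHK h39𝒢.toProp36Hypotheses.isCountable T𝒢 R𝒢)
        (D𝒢.piPresentation_hlift h39𝒢.toProp36Hypotheses.isCountable T𝒢 R𝒢)
        (fun n => (D𝒢.piLevelAut h39𝒢.toProp36Hypotheses.isCountable hconn𝒢 n).ker) hKL𝒢'.2
        (D𝒢.ker_projAut_le_ker_piLevelAut h39𝒢.toProp36Hypotheses.isCountable hconn𝒢)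
        (D𝒢.isOpen_ker_piLevelAut h39𝒢.toProp36Hypotheses.isCountable hconn𝒢)
        (D𝒢.ker_piLevelAut_anti h39𝒢.toProp36Hypotheses.isCountable hconn𝒢)
        v₀ (D𝒢.isCompact_piPresentation_H h39𝒢.toProp36Hypotheses.isCountable T𝒢 R𝒢 v₀) Rc𝒢 hRcV𝒢 ha)
      (hnobpNCpt_cosetTower_of_faithV_chart D𝒢 h39𝒢.toProp36Hypotheses.isCountable hcof𝒢 h39𝒢.toProp36Hypotheses.isConnected hS𝒢 hfin𝒢 hne𝒢 hconn𝒢 T𝒢 R𝒢 h39𝒢.thm37Hypotheses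
        hP𝒢' hKL𝒢'.2 (toOuterSemidirectProduct ρ𝒢) (fun _ => rfl) (hισ𝒢) hfaithV𝒢))
  have stabℋ := (stabBranchPairAug_chart_outerAction_modKernel Dℋ h39ℋ.toProp36Hypotheses.isCountable hcofℋ h39ℋ.toProp36Hypotheses.isConnected hSℋ hfinℋ hneℋ hconnℋ
      h39ℋ.thm37Hypotheses Tℋ Rℋ ρℋ baseActℋ hPℋ' hKLℋ'.2
      (continuous_outerSemidirectProductSnd (Dℋ.chart h39ℋ.toProp36Hypotheses.isCountable hcofℋ h39ℋ.toProp36Hypotheses.isConnected hSℋ hfinℋ hneℋ) ρℋ baseActℋ h39ℋ.toProp36Hypotheses IsTempered.of_profinite (Dℋ.piPresentation h39ℋ.toProp36Hypotheses.isCountable Tℋ Rℋ) hPℋ' wℋ hcptℋ'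
      (fun n => (Dℋ.projAut h39ℋ.toProp36Hypotheses.isCountable n).ker) (fun _ => MonoidHom.normal_ker _) hKLℋ'.1 (Dℋ.ker_projAut_anti h39ℋ.toProp36Hypotheses.isCountable)
      (Dℋ.isOpen_ker_projAut h39ℋ.toProp36Hypotheses.isCountable) (fun _ hU => Dℋ.exists_ker_projAut_subset h39ℋ.toProp36Hypotheses.isCountable hU) hK1ℋ')
      Rcℋ hRcVℋ hRcBℋ
      (fun n => isOpen_ker_arithAct_of_le (Dℋ.chart h39ℋ.toProp36Hypotheses.isCountable hcofℋ h39ℋ.toProp36Hypotheses.isConnected hSℋ hfinℋ hneℋ) ρℋ baseActℋ h39ℋ.toProp36Hypotheses IsTempered.of_profinite (Dℋ.piPresentation h39ℋ.toProp36Hypotheses.isCountable Tℋ Rℋ) hPℋ' wℋ hcptℋ'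
      (fun n => (Dℋ.projAut h39ℋ.toProp36Hypotheses.isCountable n).ker) (fun _ => MonoidHom.normal_ker _) hKLℋ'.1 (Dℋ.ker_projAut_anti h39ℋ.toProp36Hypotheses.isCountable)
      (Dℋ.isOpen_ker_projAut h39ℋ.toProp36Hypotheses.isCountable) (fun _ hU => Dℋ.exists_ker_projAut_subset h39ℋ.toProp36Hypotheses.isCountable hU) hK1ℋ'
        (hKLℋ'.2 n) (Dℋ.ker_projAut_le_ker_piLevelAut h39ℋ.toProp36Hypotheses.isCountable hconnℋ n))
      (hVc_of_cosetTower (Dℋ.chart h39ℋ.toProp36Hypotheses.isCountable hcofℋ h39ℋ.toProp36Hypotheses.isConnected hSℋ hfinℋ hneℋ) (Dℋ.piPresentation h39ℋ.toProp36Hypotheses.isCountable Tℋ Rℋ) hPℋ' (toOuterSemidirectProduct ρℋ) (outerAction_exact (Dℋ.chart h39ℋ.toProp36Hypotheses.isCountable hcofℋ h39ℋ.toProp36Hypotheses.isConnected hSℋ hfinℋ hneℋ) ρℋ h39ℋ.toProp36Hypotheses).1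
        (fun e x => conj_toOuterSemidirectProduct ρℋ e x) (fun _ => rfl) hισℋ
        (fun w' => by
        rw [Dℋ.piPresentation_H h39ℋ.toProp36Hypotheses.isCountable Tℋ Rℋ]
        exact (Tℋ w').range_decompHom_mem_verticialSubgroups_chart hcofℋ h39ℋ.toProp36Hypotheses.isConnected hSℋ hfinℋ hneℋ)
        Rcℋ hRcVℋ (fun n => (Dℋ.projAut h39ℋ.toProp36Hypotheses.isCountable n).ker) hKLℋ'.1
        (Dℋ.piPresentation_hHK h39ℋ.toProp36Hypotheses.isCountable Tℋ Rℋ) h39ℋ.thm37Hypotheses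
        (isOpen_ker_arithAct (Dℋ.chart h39ℋ.toProp36Hypotheses.isCountable hcofℋ h39ℋ.toProp36Hypotheses.isConnected hSℋ hfinℋ hneℋ) ρℋ baseActℋ h39ℋ.toProp36Hypotheses IsTempered.of_profinite (Dℋ.piPresentation h39ℋ.toProp36Hypotheses.isCountable Tℋ Rℋ) hPℋ' wℋ hcptℋ'
      (fun n => (Dℋ.projAut h39ℋ.toProp36Hypotheses.isCountable n).ker) (fun _ => MonoidHom.normal_ker _) hKLℋ'.1 (Dℋ.ker_projAut_anti h39ℋ.toProp36Hypotheses.isCountable)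
      (Dℋ.isOpen_ker_projAut h39ℋ.toProp36Hypotheses.isCountable) (fun _ hU => Dℋ.exists_ker_projAut_subset h39ℋ.toProp36Hypotheses.isCountable hU) hK1ℋ')
        (isTempered_arithLevelTopology (Dℋ.chart h39ℋ.toProp36Hypotheses.isCountable hcofℋ h39ℋ.toProp36Hypotheses.isConnected hSℋ hfinℋ hneℋ) ρℋ baseActℋ h39ℋ.toProp36Hypotheses IsTempered.of_profinite (Dℋ.piPresentation h39ℋ.toProp36Hypotheses.isCountable Tℋ Rℋ) hPℋ' wℋ hcptℋ'
      (fun n => (Dℋ.projAut h39ℋ.toProp36Hypotheses.isCountable n).ker) (fun _ => MonoidHom.normal_ker _) hKLℋ'.1 (Dℋ.ker_projAut_anti h39ℋ.toProp36Hypotheses.isCountable)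
      (Dℋ.isOpen_ker_projAut h39ℋ.toProp36Hypotheses.isCountable) (fun _ hU => Dℋ.exists_ker_projAut_subset h39ℋ.toProp36Hypotheses.isCountable hU) hK1ℋ')
        (outerSemidirectProductSnd ρℋ)
        (arithLevelTopology_nhds_hasBasis (Dℋ.chart h39ℋ.toProp36Hypotheses.isCountable hcofℋ h39ℋ.toProp36Hypotheses.isConnected hSℋ hfinℋ hneℋ) ρℋ baseActℋ h39ℋ.toProp36Hypotheses IsTempered.of_profinite (Dℋ.piPresentation h39ℋ.toProp36Hypotheses.isCountable Tℋ Rℋ) hPℋ' wℋ hcptℋ'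
      (fun n => (Dℋ.projAut h39ℋ.toProp36Hypotheses.isCountable n).ker) (fun _ => MonoidHom.normal_ker _) hKLℋ'.1 (Dℋ.ker_projAut_anti h39ℋ.toProp36Hypotheses.isCountable)
      (Dℋ.isOpen_ker_projAut h39ℋ.toProp36Hypotheses.isCountable) (fun _ hU => Dℋ.exists_ker_projAut_subset h39ℋ.toProp36Hypotheses.isCountable hU) hK1ℋ')
        (le_of_eq (outerAction_exact (Dℋ.chart h39ℋ.toProp36Hypotheses.isCountable hcofℋ h39ℋ.toProp36Hypotheses.isConnected hSℋ hfinℋ hneℋ) ρℋ h39ℋ.toProp36Hypotheses).2.1.symm)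
        hK1ℋ'
        (Dℋ.isOpen_ker_projAut h39ℋ.toProp36Hypotheses.isCountable))
      (fun n => isClosed_map_ker_arithAct_arithLevelTopology (Dℋ.chart h39ℋ.toProp36Hypotheses.isCountable hcofℋ h39ℋ.toProp36Hypotheses.isConnected hSℋ hfinℋ hneℋ) ρℋ baseActℋ (Dℋ.piPresentation h39ℋ.toProp36Hypotheses.isCountable Tℋ Rℋ) hPℋ' h39ℋ.toProp36Hypotheses IsTempered.of_profinite wℋ hcptℋ'
      (fun n => (Dℋ.projAut h39ℋ.toProp36Hypotheses.isCountable n).ker) (fun _ => MonoidHom.normal_ker _) hKLℋ'.1 (Dℋ.ker_projAut_anti h39ℋ.toProp36Hypotheses.isCountable)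
      (Dℋ.isOpen_ker_projAut h39ℋ.toProp36Hypotheses.isCountable) (fun _ hU => Dℋ.exists_ker_projAut_subset h39ℋ.toProp36Hypotheses.isCountable hU) hK1ℋ'
        (hKLℋ'.2 n) (Dℋ.ker_projAut_le_ker_piLevelAut h39ℋ.toProp36Hypotheses.isCountable hconnℋ n))
      (fun v₀ a ha => hU_arithVertGp_outerAction (Dℋ.chart h39ℋ.toProp36Hypotheses.isCountable hcofℋ h39ℋ.toProp36Hypotheses.isConnected hSℋ hfinℋ hneℋ) ρℋ baseActℋ (Dℋ.piPresentation h39ℋ.toProp36Hypotheses.isCountable Tℋ Rℋ) hPℋ' (outerAction_exact (Dℋ.chart h39ℋ.toProp36Hypotheses.isCountable hcofℋ h39ℋ.toProp36Hypotheses.isConnected hSℋ hfinℋ hneℋ) ρℋ h39ℋ.toProp36Hypotheses).2.1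
        (fun n => (Dℋ.projAut h39ℋ.toProp36Hypotheses.isCountable n).ker)
        (Dℋ.ker_projAut_anti h39ℋ.toProp36Hypotheses.isCountable) hKLℋ'.1
        (Dℋ.piPresentation_hHK h39ℋ.toProp36Hypotheses.isCountable Tℋ Rℋ)
        (Dℋ.piPresentation_hlift h39ℋ.toProp36Hypotheses.isCountable Tℋ Rℋ)
        (fun n => (Dℋ.piLevelAut h39ℋ.toProp36Hypotheses.isCountable hconnℋ n).ker) hKLℋ'.2
        (Dℋ.ker_projAut_le_ker_piLevelAut h39ℋ.toProp36Hypotheses.isCountable hconnℋ)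
        (Dℋ.isOpen_ker_piLevelAut h39ℋ.toProp36Hypotheses.isCountable hconnℋ)
        (Dℋ.ker_piLevelAut_anti h39ℋ.toProp36Hypotheses.isCountable hconnℋ)
        v₀ (Dℋ.isCompact_piPresentation_H h39ℋ.toProp36Hypotheses.isCountable Tℋ Rℋ v₀) Rcℋ hRcVℋ ha)
      (hnobpNCpt_cosetTower_of_faithV_chart Dℋ h39ℋ.toProp36Hypotheses.isCountable hcofℋ h39ℋ.toProp36Hypotheses.isConnected hSℋ hfinℋ hneℋ hconnℋ Tℋ Rℋ h39ℋ.thm37Hypotheses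
        hPℋ' hKLℋ'.2 (toOuterSemidirectProduct ρℋ) (fun _ => rfl) (hισℋ) hfaithVℋ))
  exact arithThm54_outerModels_chart_of_producers
    h39𝒢 D𝒢 hcof𝒢 hS𝒢 hfin𝒢 hne𝒢 hconn𝒢 ρ𝒢 baseAct𝒢 T𝒢 R𝒢 Rc𝒢 hV𝒢 hE𝒢 hopen𝒢 hBR𝒢 w𝒢 d𝒢 hker𝒢 hfaithV𝒢 hK1𝒢' rfl noSwitch𝒢 stab𝒢 hest𝒢 hbot𝒢
    h39ℋ Dℋ hcofℋ hSℋ hfinℋ hneℋ hconnℋ ρℋ baseActℋ Tℋ Rℋ Rcℋ hVℋ hEℋ hopenℋ hBRℋ wℋ dℋ hkerℋ hfaithVℋ hK1ℋ' rfl noSwitchℋ stabℋ hestℋ hbotℋ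
    (fun φ _ h₂ => outerSemidirectProductMap ρ𝒢 ρℋ e.toMonoidHom (φc φ.geom).toMonoidHom (compat_of_representatives ρ𝒢 ρℋ e.toMonoidHom (φc φ.geom).toMonoidHom
          (btemp_representatives_of_dict (D𝒢.chart h39𝒢.toProp36Hypotheses.isCountable hcof𝒢 h39𝒢.toProp36Hypotheses.isConnected hS𝒢 hfin𝒢 hne𝒢) (Dℋ.chart h39ℋ.toProp36Hypotheses.isCountable hcofℋ h39ℋ.toProp36Hypotheses.isConnected hSℋ hfinℋ hneℋ) ρ𝒢 ρℋ e.toMonoidHom F𝒢 θ𝒢 (fun a => Fℋ (e a)) (fun a => θℋ (e a))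
            hrep𝒢 (fun a => hrepℋ (e a)) dict θd φc hφc (fun a g => (𝔊.ρ a).hom ≫ g) (fun a g => g ≫ (ℍ.ρ (e a)).hom)
            hpre (fun a g => hpost (e a) g) φ.geom (fun a => (φ.compat a).trans (by rw [h₂ a])))) (centraliserFree_of_chartPullbackWith_iso h39𝒢.thm37Hypotheses h39ℋ.thm37Hypotheses (D𝒢.chart h39𝒢.toProp36Hypotheses.isCountable hcof𝒢 h39𝒢.toProp36Hypotheses.isConnected hS𝒢 hfin𝒢 hne𝒢) (Dℋ.chart h39ℋ.toProp36Hypotheses.isCountable hcofℋ h39ℋ.toProp36Hypotheses.isConnected hSℋ hfinℋ hneℋ) (dict φ.geom) (θd φ.geom) (hlo φ.geom) (φc φ.geom) (hφc φ.geom)))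
    hcont
    (fun φ h₁ h₂ => by
      ext p
      simp only [MonoidHom.coe_comp, Function.comp_apply, MulEquiv.coe_toMonoidHom,
        outerSemidirectProductSnd_outerSemidirectProductMap, MulEquiv.symm_apply_apply])
    dict θd hlo φc hφc hfaith hfull F𝒢 θ𝒢 hrep𝒢 hpre Fℋ θℋ hrepℋ hpost
    (fun φ h₁ h₂ => ⟨1, Subgroup.one_mem _, fun y => by
      rw [outerSemidirectProductMap_toOuterSemidirectProduct, one_mul, inv_one, mul_one]; rfl⟩)
    he

end Literature.AnabelianGeometry.SemiGraphs
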